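import Mathlib
import Summits.NavierStokesRegularity.NavierStokesRegularity.Theses.FilamentSkeletonRss
import Summits.NavierStokesRegularity.NavierStokesRegularity.Theorems.FilamentSkeletonRssSkeletonEquilibriumStraightSkeletonStrain

/-!
# The line `kelvin-sonic-negation` closes in the straight class: every witness of
`SkeletonEquilibrium` has `K > 0`
(helper for crux `FilamentSkeletonRss.SkeletonEquilibrium`, stmt-NavierStokesRegularity-15400; composes the
three `K ≤ 0` slices `StraightFilament.lengthRegular_of_nonposK`, `kelvinSonicVerticality_of_nonposK`
(`…StraightFilamentRigidity`) and `nearVerticalSubcritical_of_nonposK` (`…StraightSkeletonStrain`) exactly as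
the s1 skeleton `Lines/kelvin_sonic_negation.lean` composes its three stubs)

* `no_witness_family_of_nonposK` — for `K ≤ 0` the body of the crux (fixed data `N, γ, α, δ, ρ, K`, a
  family of witnesses at arbitrarily large `Γ` with the supercritical unique-zero clause) is FALSE:
  length-regularity holds with `C₀ = 2`, verticality with any `θ` (here `θ = 1/R`), and the subcritical
  estimate gives `w_j′(τs) ≤ ½ + C·(2/R) < 3/2 ≤ 3/2 + δ` for `R = 2C + 2`.
* `skeletonEquilibrium_iff_posK` — hence the crux is EQUIVALENT to its restriction to curvature constants
  `K > 0`: a witness skeleton is genuinely curved. (The landed `Negative.straight_lines_not_supercritical`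
  reaches the same conclusion for configurations GIVEN as affine lines; here it is derived from the crux's
  own quantifiers through the registered-shape slices, i.e. the s1 composition run end-to-end in the
  straight class.)
No summit statement is proved; NS regularity is not touched.
-/

noncomputable section

open Set Filter Topology MeasureTheory
open Literature.Analysis.FluidPDE
open scoped RealInnerProductSpace InnerProductSpace

namespace Summit.NavierStokesRegularity.NavierStokesRegularity.Theorems.SkeletonEquilibrium.StraightFilament
set_option linter.dupNamespace false

/-- **No `K ≤ 0` witness family.** For fixed data with `K ≤ 0` the body of `SkeletonEquilibrium` fails:
the three `K ≤ 0` slices of the s1 stubs compose to `w_j′(τs) < 3/2`. [folklore] -/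
theorem no_witness_family_of_nonposK (N : ℕ) (γ : Fin N → ℝ) (α δ ρ K : ℝ) (hK : K ≤ 0) :
    ¬ (0 < N ∧ α ≠ 0 ∧ 0 < δ ∧ 0 < ρ ∧ (∀ j, γ j ≠ 0) ∧ ∀ Γ₀ : ℝ, ∃ Γ : ℝ, Γ₀ ≤ Γ ∧ 0 < Γ ∧
      ∃ (Ξ : Fin N → ℝ → EuclideanSpace ℝ (Fin 3)) (w : Fin N → ℝ → ℝ),
        (∀ j, ContDiff ℝ 2 (Ξ j) ∧ Function.Injective (Ξ j) ∧ Differentiable ℝ (w j) ∧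
          (∀ τ, ‖deriv (Ξ j) τ‖ = 1) ∧ (∀ τ, ‖iteratedDeriv 2 (Ξ j) τ‖ * Real.sqrt Γ ≤ K) ∧
          Filter.Tendsto (fun τ => ‖Ξ j τ‖) Filter.atTop Filter.atTop ∧
          Filter.Tendsto (fun τ => ‖Ξ j τ‖) Filter.atBot Filter.atTop) ∧
        (∀ j k, j ≠ k → ∀ τ σ, ρ * Real.sqrt Γ ≤ ‖Ξ j τ - Ξ k σ‖) ∧
        (∀ j (x : EuclideanSpace ℝ (Fin 3)), MeasureTheory.Integrable (fun σ : ℝ =>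
          ((‖x - Ξ j σ‖ ^ 2 + 1) ^ (3 / 2 : ℝ))⁻¹ •
            Literature.Analysis.FluidPDE.cross (deriv (Ξ j) σ) (x - Ξ j σ))) ∧
        (∀ j τ, (∑ k : Fin N, (Γ * γ k / (4 * Real.pi)) • ∫ σ : ℝ,
            ((‖Ξ j τ - Ξ k σ‖ ^ 2 + 1) ^ (3 / 2 : ℝ))⁻¹ •
              Literature.Analysis.FluidPDE.cross (deriv (Ξ k) σ) (Ξ j τ - Ξ k σ))
            + (1 / 2 : ℝ) • Ξ j τ
            - α • Literature.Analysis.FluidPDE.cross (EuclideanSpace.single (2 : Fin 3) (1 : ℝ)) (Ξ j τ)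
            = w j τ • deriv (Ξ j) τ) ∧
        (∀ j, ∃ τs : ℝ, w j τs = 0 ∧ (∀ τ, w j τ = 0 → τ = τs) ∧ 3 / 2 + δ ≤ deriv (w j) τs)) := by
  rintro ⟨hN, hα, hδ, hρ, -, hfam⟩
  obtain ⟨C₀, hC₀, hLR⟩ := lengthRegular_of_nonposK N γ α ρ K hα hρ hK
  obtain ⟨C, hC, hNV⟩ := nearVerticalSubcritical_of_nonposK N γ α ρ K C₀ hρ hC₀ hK
  set R : ℝ := 2 * C + 2 with hR
  have hR1 : 1 ≤ R := by rw [hR]; linarith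
  have hR0 : 0 < R := by linarith
  have hθ : 0 < 1 / R := by positivity
  have hθ1 : 1 / R ≤ 1 := by rw [div_le_one hR0]; exact hR1
  obtain ⟨Γ₁, hKS⟩ := kelvinSonicVerticality_of_nonposK N γ α ρ K C₀ hα hρ hC₀ hK (1 / R) hθ R hR1
  obtain ⟨Γ, hΓ₁, _, Ξ, w, hcl, hsep, hint, heq, hSC⟩ := hfam (max Γ₁ 1)
  have hΓ1 : 1 ≤ Γ := le_trans (le_max_right _ _) hΓ₁
  have hΓΓ₁ : Γ₁ ≤ Γ := le_trans (le_max_left _ _) hΓ₁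
  have hlr := hLR Γ hΓ1 Ξ w hcl hsep hint heq
  have hvert := hKS Γ hΓΓ₁ hΓ1 Ξ w hcl hsep hint heq hlr
  set j : Fin N := ⟨0, hN⟩ with hj
  obtain ⟨τs, hw0, -, hsc⟩ := hSC j
  have hw' := hNV (1 / R) R Γ hθ hθ1 hR1 hΓ1 Ξ w hcl hsep hint heq hlr j τs hw0 (hvert j τs hw0)
  -- `C · (1/R + 1/R) = 2C/(2C+2) < 1`
  have hsmall : C * (1 / R + 1 / R) < 1 := by
    rw [show C * (1 / R + 1 / R) = 2 * C / R by ring, div_lt_one hR0, hR]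
    linarith
  linarith

/-- **WLOG `K > 0`.** `SkeletonEquilibrium` is equivalent to its restriction to curvature constants
`K > 0`: any witness skeleton is genuinely curved (the straight class `K ≤ 0` is excluded by
`no_witness_family_of_nonposK`). [folklore] -/
theorem skeletonEquilibrium_iff_posK :
    Summit.NavierStokesRegularity.NavierStokesRegularity.Theses.FilamentSkeletonRss.SkeletonEquilibrium ↔
    ∃ (N : ℕ) (γ : Fin N → ℝ) (α δ ρ K : ℝ), 0 < K ∧ (0 < N ∧ α ≠ 0 ∧ 0 < δ ∧ 0 < ρ ∧ (∀ j, γ j ≠ 0) ∧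
      ∀ Γ₀ : ℝ, ∃ Γ : ℝ, Γ₀ ≤ Γ ∧ 0 < Γ ∧
      ∃ (Ξ : Fin N → ℝ → EuclideanSpace ℝ (Fin 3)) (w : Fin N → ℝ → ℝ),
        (∀ j, ContDiff ℝ 2 (Ξ j) ∧ Function.Injective (Ξ j) ∧ Differentiable ℝ (w j) ∧
          (∀ τ, ‖deriv (Ξ j) τ‖ = 1) ∧ (∀ τ, ‖iteratedDeriv 2 (Ξ j) τ‖ * Real.sqrt Γ ≤ K) ∧
          Filter.Tendsto (fun τ => ‖Ξ j τ‖) Filter.atTop Filter.atTop ∧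
          Filter.Tendsto (fun τ => ‖Ξ j τ‖) Filter.atBot Filter.atTop) ∧
        (∀ j k, j ≠ k → ∀ τ σ, ρ * Real.sqrt Γ ≤ ‖Ξ j τ - Ξ k σ‖) ∧
        (∀ j (x : EuclideanSpace ℝ (Fin 3)), MeasureTheory.Integrable (fun σ : ℝ =>
          ((‖x - Ξ j σ‖ ^ 2 + 1) ^ (3 / 2 : ℝ))⁻¹ •
            Literature.Analysis.FluidPDE.cross (deriv (Ξ j) σ) (x - Ξ j σ))) ∧
        (∀ j τ, (∑ k : Fin N, (Γ * γ k / (4 * Real.pi)) • ∫ σ : ℝ,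
            ((‖Ξ j τ - Ξ k σ‖ ^ 2 + 1) ^ (3 / 2 : ℝ))⁻¹ •
              Literature.Analysis.FluidPDE.cross (deriv (Ξ k) σ) (Ξ j τ - Ξ k σ))
            + (1 / 2 : ℝ) • Ξ j τ
            - α • Literature.Analysis.FluidPDE.cross (EuclideanSpace.single (2 : Fin 3) (1 : ℝ)) (Ξ j τ)
            = w j τ • deriv (Ξ j) τ) ∧
        (∀ j, ∃ τs : ℝ, w j τs = 0 ∧ (∀ τ, w j τ = 0 → τ = τs) ∧ 3 / 2 + δ ≤ deriv (w j) τs)) := by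
  unfold Summit.NavierStokesRegularity.NavierStokesRegularity.Theses.FilamentSkeletonRss.SkeletonEquilibrium
  constructor
  · rintro ⟨N, γ, α, δ, ρ, K, h⟩
    by_cases hK : 0 < K
    · exact ⟨N, γ, α, δ, ρ, K, hK, h⟩
    · exact absurd h (no_witness_family_of_nonposK N γ α δ ρ K (not_lt.1 hK))
  · rintro ⟨N, γ, α, δ, ρ, K, -, h⟩
    exact ⟨N, γ, α, δ, ρ, K, h⟩

/-- **Single-`Γ` sharpening: slope `≤ ½` at every zero of the slip.** For `K ≤ 0`, `α ≠ 0` and ANY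
`Γ ≥ 1`, every configuration satisfying the per-filament clauses, separation, integrability and the
relative-equilibrium relation has `w_j′(τs) ≤ ½` at every zero `τs` of `w_j` (exact verticality from
`vertical_lines_of_nonposK` feeds the subcritical slice with every `θ = 1/R`, `R → ∞`). In particular
the three registered stubs that CARRY the supercritical clause `3/2 + δ ≤ w_j′(τs)` as a hypothesis
(`stub_rippleFree`, `stub_strandSeparation`, `stub_zeroAccretionShadowing`) are vacuous in the straight
class at every single `Γ ≥ 1`, not only along families `Γ → ∞`. [folklore] -/
theorem slope_le_half_of_nonposK {N : ℕ} {γ : Fin N → ℝ} {α ρ K Γ : ℝ} (hα : α ≠ 0) (hρ : 0 < ρ)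
    (hK : K ≤ 0) (hΓ : 1 ≤ Γ) {Ξ : Fin N → ℝ → EuclideanSpace ℝ (Fin 3)} {w : Fin N → ℝ → ℝ}
    (hcl : ∀ j, ContDiff ℝ 2 (Ξ j) ∧ Function.Injective (Ξ j) ∧ Differentiable ℝ (w j) ∧
      (∀ τ, ‖deriv (Ξ j) τ‖ = 1) ∧ (∀ τ, ‖iteratedDeriv 2 (Ξ j) τ‖ * Real.sqrt Γ ≤ K) ∧
      Filter.Tendsto (fun τ => ‖Ξ j τ‖) Filter.atTop Filter.atTop ∧
      Filter.Tendsto (fun τ => ‖Ξ j τ‖) Filter.atBot Filter.atTop)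
    (hsep : ∀ j k, j ≠ k → ∀ τ σ, ρ * Real.sqrt Γ ≤ ‖Ξ j τ - Ξ k σ‖)
    (hint : ∀ j (x : EuclideanSpace ℝ (Fin 3)), MeasureTheory.Integrable (fun σ : ℝ =>
      ((‖x - Ξ j σ‖ ^ 2 + 1) ^ (3 / 2 : ℝ))⁻¹ •
        Literature.Analysis.FluidPDE.cross (deriv (Ξ j) σ) (x - Ξ j σ)))
    (heq : ∀ j τ, (∑ k : Fin N, (Γ * γ k / (4 * Real.pi)) • ∫ σ : ℝ,
        ((‖Ξ j τ - Ξ k σ‖ ^ 2 + 1) ^ (3 / 2 : ℝ))⁻¹ •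
          Literature.Analysis.FluidPDE.cross (deriv (Ξ k) σ) (Ξ j τ - Ξ k σ))
        + (1 / 2 : ℝ) • Ξ j τ
        - α • Literature.Analysis.FluidPDE.cross (EuclideanSpace.single (2 : Fin 3) (1 : ℝ)) (Ξ j τ)
        = w j τ • deriv (Ξ j) τ)
    (j : Fin N) {τs : ℝ} (hw0 : w j τs = 0) : deriv (w j) τs ≤ 1 / 2 := by
  obtain ⟨C₀, hC₀, hLR⟩ := lengthRegular_of_nonposK N γ α ρ K hα hρ hK
  obtain ⟨C, hC, hNV⟩ := nearVerticalSubcritical_of_nonposK N γ α ρ K C₀ hρ hC₀ hK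
  have hlr := hLR Γ hΓ Ξ w hcl hsep hint heq
  have hvl := vertical_lines_of_nonposK (γ := γ) hα hK hΓ hcl heq
  -- exact verticality: `‖Ξ k′(τ) × e₃‖ = 0`
  have hvert : ∀ (θ : ℝ), 0 < θ → ∀ (k : Fin N) (τ : ℝ),
      ‖Literature.Analysis.FluidPDE.cross (deriv (Ξ k) τ) (EuclideanSpace.single (2 : Fin 3) (1 : ℝ))‖
        ≤ θ := by
    intro θ hθ k τ
    obtain ⟨hder, -, -, hv⟩ := hvl k
    have hswap : Literature.Analysis.FluidPDE.cross (deriv (Ξ k) 0) (EuclideanSpace.single (2 : Fin 3) (1 : ℝ))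
        = -Literature.Analysis.FluidPDE.cross (EuclideanSpace.single (2 : Fin 3) (1 : ℝ)) (deriv (Ξ k) 0) := by
      ext i
      fin_cases i <;>
        simp [Literature.Analysis.FluidPDE.Tao2016.cross_apply_zero,
          Literature.Analysis.FluidPDE.Tao2016.cross_apply_one,
          Literature.Analysis.FluidPDE.Tao2016.cross_apply_two]
    rw [hder τ, hswap, hv, neg_zero, norm_zero]
    exact hθ.le
  -- `w′ ≤ ½ + 2C/R` for every `R ≥ 1`
  have hR : ∀ R : ℝ, 1 ≤ R → deriv (w j) τs ≤ 1 / 2 + C * (1 / R + 1 / R) := by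
    intro R hR1
    have hR0 : 0 < R := by linarith
    have hθ : 0 < 1 / R := by positivity
    have hθ1 : 1 / R ≤ 1 := by rw [div_le_one hR0]; exact hR1
    exact hNV (1 / R) R Γ hθ hθ1 hR1 hΓ Ξ w hcl hsep hint heq hlr j τs hw0
      (fun k τ _ => hvert (1 / R) hθ k τ)
  refine le_of_forall_pos_le_add fun ε hε => ?_
  have hCε : 0 ≤ 2 * C / ε := by positivity
  have h := hR (2 * C / ε + 1) (by linarith)
  have hden : 0 < 2 * C / ε + 1 := by positivity
  have hkey : C * (1 / (2 * C / ε + 1) + 1 / (2 * C / ε + 1)) ≤ ε := by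
    rw [show C * (1 / (2 * C / ε + 1) + 1 / (2 * C / ε + 1)) = 2 * C / (2 * C / ε + 1) by ring,
      div_le_iff₀ hden]
    have hexp : ε * (2 * C / ε + 1) = 2 * C + ε := by field_simp
    rw [hexp]
    linarith
  linarith

end Summit.NavierStokesRegularity.NavierStokesRegularity.Theorems.SkeletonEquilibrium.StraightFilament
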